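import Mathlib

/-!
# `SgCorridor` (stmt-HubbardSuperconductivity-16274, route `ColourTheSpin`) — negative side:
# the ABSTRACT corridor-transfer shape is false (load-bearing analysis: "without the model")

The crux `SgCorridor := SgAnchorOrder → SgCorridorOrder` transfers EVERY-GROUND-STATE order of the
`N_L`-block of the `Q8`-spin-gauged torus `H_g = T + U·D + g²·(1 ⊗ Σ_b E_b) + g⁻²·(1 ⊗ M)` from the
strong-coupling half-line `g ≥ g₀` (one constant `c`) to the corridor `g ∈ (0, g₀]` (one constant
`c'`). The item's own "why it might fail" is the finite-group DECONFINEMENT crossing: the large-`g`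
ground states (electric vacuum) and the small-`g` ground states (magnetic / flat sector) are different
states, and order of the former says nothing about the latter.

This file records that worry as a sorry-free theorem about the crux's SHAPE. Keep of `H_g` only what
bookkeeping can see — a Hermitian `g`-independent part `T`, an "electric" positive semidefinite `E`
weighted `g²`, a "magnetic" positive semidefinite `M` weighted `g⁻²` (coefficients coerced `ℝ → ℂ`
exactly as in the route items), a positive semidefinite order observable `O`, ground states and order
typed VERBATIM as in the route items (`ψ ≠ 0 ∧ ∃ e : ℝ, H ψ = e•ψ ∧ ∀ φ, e·‖φ‖² ≤ Re⟨φ,Hφ⟩`, order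
`c·‖ψ‖² ≤ Re⟨ψ,Oψ⟩`). Then "order `≥ c‖ψ‖²` in every ground state for all `g ≥ g₀`" does NOT imply
"order `≥ c'‖ψ‖²`, `c' > 0`, in every ground state for all `g ∈ (0, g₀]`": the two-level family
`diag(g⁻², g²)` (`T = 0`, `E = diag(0,1)`, `M = diag(1,0)`) with `O = diag(1,0)` is lit (`O = 1` on the
unique ground ray `e₀`) for `g > 1` and dark (`O = 0` on the ground state `e₁`) for `g < 1` — an
electric/magnetic LEVEL CROSSING at `g = 1`, strictly inside the corridor of `g₀ = 2`.

* `not_abstractCorridorShape` — `¬ ∀ (T E M O : Matrix (Fin 2) (Fin 2) ℂ), T Hermitian → E, M, O ≥ 0 →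
  ∀ g₀ > 0, ∀ c > 0, (order ≥ c in every ground state of T + g²E + g⁻²M for all g ≥ g₀) →
  ∃ c' > 0, (order ≥ c' in every ground state for all g ∈ (0, g₀])` (refuting the shape on `Fin 2`
  refutes it over every index type with two points).

Reading for the crux: as typed, `SgCorridor` holds VACUOUSLY (its hypothesis `SgAnchorOrder` is
refuted by strong-coupling link freezing — `Theorems/SgCorridor/Negative/AnchorFreeze*.lean`,
`Theorems/SgAnchorOrder/Negative/*.lean`); any REPAIRED, non-vacuous corridor transfer (anchor at one
coupling, `g`-dependent constants) must use structure of the gauged Hubbard torus beyond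
`T + g²E + g⁻²M`, hermiticity and positivity — i.e. control of the deconfinement crossing itself.
Elementary linear algebra; folklore (level crossing). Refuter cdisprove, 2026-08-17.
-/

noncomputable section

namespace Summit.HubbardSuperconductivity.SgCorridorNegative

open Matrix
open scoped ComplexOrder

/-! ### The two-level witness `diag(g⁻², g²)`, `O = diag(1, 0)` -/

/-- `diag(a, b) ≥ 0` for real `a, b ≥ 0`. [folklore] -/
theorem diag_posSemidef {a b : ℝ} (ha : 0 ≤ a) (hb : 0 ≤ b) :
    (Matrix.diagonal ![(a : ℂ), (b : ℂ)]).PosSemidef := by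
  rw [Matrix.posSemidef_diagonal_iff]
  intro i
  fin_cases i
  · simpa using ha
  · simpa using hb

/-- Quadratic form of `diag(a, b)`: `Re⟨φ, diag(a,b) φ⟩ = a‖φ₀‖² + b‖φ₁‖²`. [folklore] -/
theorem re_form_diag (a b : ℝ) (φ : Fin 2 → ℂ) :
    (star φ ⬝ᵥ Matrix.diagonal ![(a : ℂ), (b : ℂ)] *ᵥ φ).re =
      a * Complex.normSq (φ 0) + b * Complex.normSq (φ 1) := by
  simp only [dotProduct, Fin.sum_univ_two, Matrix.mulVec_diagonal, Matrix.cons_val_zero,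
    Matrix.cons_val_one, Pi.star_apply, Complex.star_def, Complex.add_re,
    Complex.mul_re, Complex.mul_im, Complex.conj_re, Complex.conj_im, Complex.ofReal_re,
    Complex.ofReal_im, Complex.normSq_apply]
  ring

/-- `Re⟨φ, φ⟩ = ‖φ₀‖² + ‖φ₁‖²`. [folklore] -/
theorem re_norm (φ : Fin 2 → ℂ) :
    (star φ ⬝ᵥ φ).re = Complex.normSq (φ 0) + Complex.normSq (φ 1) := by
  simp only [dotProduct, Fin.sum_univ_two, Pi.star_apply, Complex.star_def, Complex.add_re,
    Complex.mul_re, Complex.conj_re, Complex.conj_im, Complex.normSq_apply]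
  ring

/-- Second component of `diag(a, b) ψ`: `b ψ₁`. [folklore] -/
theorem diag_mulVec_one (a b : ℝ) (ψ : Fin 2 → ℂ) :
    (Matrix.diagonal ![(a : ℂ), (b : ℂ)] *ᵥ ψ) 1 = (b : ℂ) * ψ 1 := by
  simp [Matrix.mulVec_diagonal]

/-- The witness family `T = 0`, `E = diag(0,1)`, `M = diag(1,0)` at coupling `g` is `diag(g⁻², g²)`.
[folklore] -/
theorem family_eq (g : ℝ) :
    (0 : Matrix (Fin 2) (Fin 2) ℂ) + ((g ^ 2 : ℝ) : ℂ) • Matrix.diagonal ![((0 : ℝ) : ℂ), ((1 : ℝ) : ℂ)]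
        + ((1 / g ^ 2 : ℝ) : ℂ) • Matrix.diagonal ![((1 : ℝ) : ℂ), ((0 : ℝ) : ℂ)] =
      Matrix.diagonal ![((1 / g ^ 2 : ℝ) : ℂ), ((g ^ 2 : ℝ) : ℂ)] := by
  ext i j
  fin_cases i <;> fin_cases j <;> simp [Matrix.diagonal]

/-- **HYPOTHESIS OF THE SHAPE HOLDS for the witness** with `g₀ = 2`, `c = 1`, `O = diag(1,0)`: for
`g ≥ 2` every ground state (route typing) of `diag(g⁻², g²)` lies on the ray of `e₀` (its eigenvalue is
`≤ g⁻² < g²`), where `O = 1`. [folklore] -/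
theorem witness_lit {g : ℝ} (hg : 2 ≤ g) (ψ : Fin 2 → ℂ)
    (hψ : ψ ≠ 0 ∧ ∃ e : ℝ, Matrix.diagonal ![((1 / g ^ 2 : ℝ) : ℂ), ((g ^ 2 : ℝ) : ℂ)] *ᵥ ψ = (e : ℂ) • ψ ∧
      ∀ φ : Fin 2 → ℂ, e * (star φ ⬝ᵥ φ).re ≤
        (star φ ⬝ᵥ Matrix.diagonal ![((1 / g ^ 2 : ℝ) : ℂ), ((g ^ 2 : ℝ) : ℂ)] *ᵥ φ).re) :
    1 * (star ψ ⬝ᵥ ψ).re ≤ (star ψ ⬝ᵥ Matrix.diagonal ![((1 : ℝ) : ℂ), ((0 : ℝ) : ℂ)] *ᵥ ψ).re := by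
  obtain ⟨-, e, heig, hray⟩ := hψ
  have hg2 : (4 : ℝ) ≤ g ^ 2 := by nlinarith
  have hgi : 1 / g ^ 2 ≤ 1 / 4 := one_div_le_one_div_of_le (by norm_num) hg2
  -- Rayleigh bound at `e₀`: `e ≤ g⁻²`
  have h1 := hray ![1, 0]
  rw [re_norm, re_form_diag] at h1
  simp only [Matrix.cons_val_zero, Matrix.cons_val_one, map_one, map_zero,
    mul_one, mul_zero, add_zero] at h1
  -- eigen-equation, second component: `g² ψ₁ = e ψ₁`
  have h2 := congrFun heig 1
  rw [diag_mulVec_one, Pi.smul_apply, smul_eq_mul] at h2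
  by_cases hψ1 : ψ 1 = 0
  · rw [re_norm, re_form_diag, hψ1, map_zero]
    simp
  · exfalso
    have h3 : ((g ^ 2 : ℝ) : ℂ) = (e : ℂ) := mul_right_cancel₀ hψ1 h2
    have h4 : g ^ 2 = e := by exact_mod_cast h3
    linarith

/-- **CONCLUSION OF THE SHAPE FAILS for the witness**: at `g = 1/2 ∈ (0, 2]` the vector `e₁` is a
ground state (route typing) of `diag(4, 1/4)`, and `O = diag(1,0)` vanishes on it. [folklore] -/
theorem witness_dark :
    ((![0, 1] : Fin 2 → ℂ) ≠ 0 ∧ ∃ e : ℝ,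
        Matrix.diagonal ![((1 / (1 / 2) ^ 2 : ℝ) : ℂ), (((1 / 2) ^ 2 : ℝ) : ℂ)] *ᵥ ![0, 1] = (e : ℂ) • ![0, 1] ∧
        ∀ φ : Fin 2 → ℂ, e * (star φ ⬝ᵥ φ).re ≤
          (star φ ⬝ᵥ Matrix.diagonal ![((1 / (1 / 2) ^ 2 : ℝ) : ℂ), (((1 / 2) ^ 2 : ℝ) : ℂ)] *ᵥ φ).re) ∧
      (star ![(0 : ℂ), 1] ⬝ᵥ Matrix.diagonal ![((1 : ℝ) : ℂ), ((0 : ℝ) : ℂ)] *ᵥ ![0, 1]).re = 0 := by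
  refine ⟨⟨?_, 1 / 4, ?_, ?_⟩, ?_⟩
  · intro h0
    have := congrFun h0 1
    simp at this
  · funext i
    fin_cases i
    · simp [Matrix.mulVec_diagonal]
    · simp [Matrix.mulVec_diagonal]
      norm_num
  · intro φ
    rw [re_norm, re_form_diag]
    norm_num
    nlinarith [Complex.normSq_nonneg (φ 0), Complex.normSq_nonneg (φ 1)]
  · rw [re_form_diag]
    simp

/-- **The abstract corridor-transfer shape is FALSE** (electric/magnetic level crossing at `g = 1`
inside the corridor `(0, 2]`): hermiticity of `T`, positivity of `E`, `M`, `O` and the coupling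
structure `T + g²E + g⁻²M` do not transport every-ground-state order (route typing of ground states and
order) from a strong-coupling half-line `[g₀, ∞)` to the weak-coupling corridor `(0, g₀]`. Any proof of
a non-vacuous (repaired) `SgCorridor` must use the specific dynamics of the `Q8`-gauged Hubbard torus
across its deconfinement crossing. [folklore] -/
theorem not_abstractCorridorShape :
    ¬ ∀ (T E M O : Matrix (Fin 2) (Fin 2) ℂ), T.IsHermitian → E.PosSemidef → M.PosSemidef →
        O.PosSemidef → ∀ (g₀ c : ℝ), 0 < g₀ → 0 < c →
        (∀ g : ℝ, g₀ ≤ g → ∀ ψ : Fin 2 → ℂ,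
            (ψ ≠ 0 ∧ ∃ e : ℝ, (T + ((g ^ 2 : ℝ) : ℂ) • E + ((1 / g ^ 2 : ℝ) : ℂ) • M) *ᵥ ψ = (e : ℂ) • ψ ∧
              ∀ φ : Fin 2 → ℂ, e * (star φ ⬝ᵥ φ).re ≤
                (star φ ⬝ᵥ (T + ((g ^ 2 : ℝ) : ℂ) • E + ((1 / g ^ 2 : ℝ) : ℂ) • M) *ᵥ φ).re) →
            c * (star ψ ⬝ᵥ ψ).re ≤ (star ψ ⬝ᵥ O *ᵥ ψ).re) →
        ∃ c' : ℝ, 0 < c' ∧ ∀ g : ℝ, 0 < g → g ≤ g₀ → ∀ ψ : Fin 2 → ℂ,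
            (ψ ≠ 0 ∧ ∃ e : ℝ, (T + ((g ^ 2 : ℝ) : ℂ) • E + ((1 / g ^ 2 : ℝ) : ℂ) • M) *ᵥ ψ = (e : ℂ) • ψ ∧
              ∀ φ : Fin 2 → ℂ, e * (star φ ⬝ᵥ φ).re ≤
                (star φ ⬝ᵥ (T + ((g ^ 2 : ℝ) : ℂ) • E + ((1 / g ^ 2 : ℝ) : ℂ) • M) *ᵥ φ).re) →
            c' * (star ψ ⬝ᵥ ψ).re ≤ (star ψ ⬝ᵥ O *ᵥ ψ).re := by
  intro h
  have hyp : ∀ g : ℝ, 2 ≤ g → ∀ ψ : Fin 2 → ℂ,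
      (ψ ≠ 0 ∧ ∃ e : ℝ, ((0 : Matrix (Fin 2) (Fin 2) ℂ)
          + ((g ^ 2 : ℝ) : ℂ) • Matrix.diagonal ![((0 : ℝ) : ℂ), ((1 : ℝ) : ℂ)]
          + ((1 / g ^ 2 : ℝ) : ℂ) • Matrix.diagonal ![((1 : ℝ) : ℂ), ((0 : ℝ) : ℂ)]) *ᵥ ψ = (e : ℂ) • ψ ∧
        ∀ φ : Fin 2 → ℂ, e * (star φ ⬝ᵥ φ).re ≤
          (star φ ⬝ᵥ ((0 : Matrix (Fin 2) (Fin 2) ℂ)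
            + ((g ^ 2 : ℝ) : ℂ) • Matrix.diagonal ![((0 : ℝ) : ℂ), ((1 : ℝ) : ℂ)]
            + ((1 / g ^ 2 : ℝ) : ℂ) • Matrix.diagonal ![((1 : ℝ) : ℂ), ((0 : ℝ) : ℂ)]) *ᵥ φ).re) →
      1 * (star ψ ⬝ᵥ ψ).re ≤ (star ψ ⬝ᵥ Matrix.diagonal ![((1 : ℝ) : ℂ), ((0 : ℝ) : ℂ)] *ᵥ ψ).re := by
    intro g hg ψ hψ
    rw [family_eq] at hψ
    exact witness_lit hg ψ hψ
  obtain ⟨c', hc', hcorr⟩ := h 0 (Matrix.diagonal ![((0 : ℝ) : ℂ), ((1 : ℝ) : ℂ)])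
    (Matrix.diagonal ![((1 : ℝ) : ℂ), ((0 : ℝ) : ℂ)]) (Matrix.diagonal ![((1 : ℝ) : ℂ), ((0 : ℝ) : ℂ)])
    Matrix.isHermitian_zero (diag_posSemidef le_rfl zero_le_one) (diag_posSemidef zero_le_one le_rfl)
    (diag_posSemidef zero_le_one le_rfl) 2 1 (by norm_num) (by norm_num) hyp
  obtain ⟨hGS, hO⟩ := witness_dark
  have h1 := hcorr (1 / 2) (by norm_num) (by norm_num) ![0, 1] (by rw [family_eq]; exact hGS)
  rw [hO, re_norm] at h1
  simp only [Matrix.cons_val_zero, Matrix.cons_val_one, map_one, map_zero, zero_add, mul_one] at h1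
  linarith

end Summit.HubbardSuperconductivity.SgCorridorNegative

end
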